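import Summits.BirchSwinnertonDyer.BirchSwinnertonDyer.Theorems.PAdicOrderV2PAdicOrderThesisR2StubRankRegulatorOfNonSquarePair
import Literature.NumberTheory.QuadraticForms.PadicBinaryFormSquareClasses
import Literature.NumberTheory.EllipticCurves.IwasawaLeadingTermProofs
import Literature.NumberTheory.EllipticCurves.SelmerCorankHolds
import Literature.NumberTheory.EllipticCurves.CanonicalPAdicHeightHolds
import Literature.Barriers.BirchSwinnertonDyer.SelmerVersusMordellWeilProofs
import Literature.NumberTheory.EllipticCurves.PAdicLFunction
import Literature.NumberTheory.EllipticCurves.AnalyticRank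
import Literature.NumberTheory.EllipticCurves.Isogeny
import Literature.NumberTheory.EllipticCurves.GaloisAction

/-!
# BirchSwinnertonDyer / PAdicOrderV2 — crux `PAdicOrderThesisR2` (stmt-0487), line
# `lambda-adic-gz-square-class`: TIGHTNESS of the idea-stub K (`stub_shadowPrime_rankTwo`)

The load-bearing stub K of the line (skeleton `Cruxes/PAdicOrderThesisR2/Lines/
lambda_adic_gz_square_class.lean`) asserts, for every non-CM elliptic `E/ℚ` (globally minimal
`W`) of analytic rank `2`, ONE good ordinary prime `p ≥ 5` with `E[p]` irreducible at which
(i) `corank_{ℤ_p} Sel_{p^∞}(E/ℚ) ≤ 2` and (ii) for every canonical `p`-adic height datum there are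
rational points `P, Q` with non-zero heights of NON-SQUARE ratio in `ℚ_p`. With the landed glue
G (`stub_rank_regulator_of_nonSquarePair`, p148465) and the squeeze
`mordellWeilRank_eq_of_le_of_selmerCorank_le_holds` the skeleton derives from K the sector
target "`rank_ℤ E(ℚ) = 2` ∧ (J) at `p`" ((J): `Ш(E/ℚ)[p^∞]` finite and Schneider non-degeneracy
for every canonical datum) — theorem `shadowSector_of_stubs` there.

This file proves the CONVERSE unconditionally — **the sector target at `p` implies K at `p`**
(`shadowPrime_at_of_sector`) — and packages both directions as ONE kernel-checked equivalence
`shadowPrime_iff_sector`: on {non-CM, `r_an = 2`}, K ⟺ "BSD-rank ∧ (J)". So typed K is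
exactly the sector target in the currency of square classes, neither stronger nor weaker; the
mechanism of the idea (two Heegner fields with non-square ratio of `Λ`-adic Gross–Zagier
coefficients, Howard 2005) lives entirely in HOW K would be proved, not in its statement. The
registered helper `stub_shadowPrime_rankTwo_of_sector` is the direction "sector ⟹ K verbatim".

Ingredients: `exists_nonSquarePair_of_rank_two` — for `E/ℚ` of Mordell–Weil rank `2`, ANY height
datum `D` with `Reg_p(E, D) ≠ 0` (`p ≠ 2`) has two rational points with non-zero `D`-heights of
non-square ratio: `Reg_p` is the Gram determinant `ac - b²` on a Mordell–Weil basis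
(`IsMordellWeilBasis.padicRegulatorOf_eq_padicRegulator`, `Matrix.det_fin_two`; Mazur–Stein–Tate
2006 §1) and a non-degenerate binary form over `ℚ_p` represents two square classes AT INTEGER
POINTS (`Literature.NumberTheory.QuadraticForms.exists_int_ratio_not_isSquare_of_det_ne_zero`,
Serre Ch. II §3.3 / IV §2); with G: `exists_nonSquarePair_iff_schneider`. And
`selmerCorank_le_two_of_rank_two` (Kummer corank identity + `Ш[p^∞]` finite `↔ corank Ш = 0`).
-/

-- single-conjunct summit: `Summit.BirchSwinnertonDyer.BirchSwinnertonDyer.…` repeats the name by design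
set_option linter.dupNamespace false

noncomputable section

namespace Summit.BirchSwinnertonDyer.BirchSwinnertonDyer.Cruxes.PAdicOrderThesisR2.LambdaAdicGZ

open Literature.NumberTheory.EllipticCurves Literature.NumberTheory.QuadraticForms

/-! ### Rank two: the Gram form of a height datum on a Mordell–Weil basis -/

section Curve

variable {W : WeierstrassCurve ℚ} [W.IsElliptic] {p : ℕ} [hp : Fact p.Prime]

omit [W.IsElliptic] in
/-- The `D`-height of an integer combination `m B₀ + n B₁` of a `Fin 2`-indexed family is the
value of the Gram form `⟨B₀,B₀⟩ m² + 2⟨B₀,B₁⟩ m n + ⟨B₁,B₁⟩ n²` (bilinearity, symmetry,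
torsion-vanishing; the coordinate expansion `pairing_eq_sum_sum` of the landed glue G).
[cite: MazurTateTeitelbaum1986Invent, §II.4] -/
theorem pairing_comb_self (D : WeierstrassCurve.PAdicHeightData W p)
    {B : Fin 2 → W.toAffine.Point} (m n : ℤ) :
    D.pairing (∑ i, ![m, n] i • B i) (∑ i, ![m, n] i • B i) =
      D.pairing (B 0) (B 0) * (m : ℚ_[p]) ^ 2 + 2 * D.pairing (B 0) (B 1) * m * n +
        D.pairing (B 1) (B 1) * (n : ℚ_[p]) ^ 2 := by
  have hc : IsOfFinAddOrder ((∑ i, ![m, n] i • B i) - ∑ i, ![m, n] i • B i) := by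
    rw [sub_self]
    exact IsOfFinAddOrder.zero
  rw [pairing_eq_sum_sum D B hc hc]
  simp only [Fin.sum_univ_two, Matrix.cons_val_zero, Matrix.cons_val_one, D.symm (B 1) (B 0)]
  ring

/-- **Rank two and Schneider non-degeneracy give a non-square pair** (`p ≠ 2`): if
`rank_ℤ E(ℚ) = 2` and `Reg_p(E, D) ≠ 0` for a height datum `D`, there are rational points
`P, Q` with `⟨P,P⟩_D ≠ 0`, `⟨Q,Q⟩_D ≠ 0` and `⟨P,P⟩_D / ⟨Q,Q⟩_D` not a square in `ℚ_p`. Proof: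
`Reg_p` is the Gram determinant `ac - b²` on a Mordell–Weil basis (`padicRegulatorOf_eq_padicRegulator`,
`Matrix.det_fin_two`), and a non-degenerate binary form over `ℚ_p` represents two square classes
at integer points (`exists_int_ratio_not_isSquare_of_det_ne_zero`). This is the converse of the
landed glue `stub_rank_regulator_of_nonSquarePair` in rank `2`.
[cite: MazurSteinTate2006, §1] -/
theorem exists_nonSquarePair_of_rank_two (hp2 : p ≠ 2) (D : WeierstrassCurve.PAdicHeightData W p)
    (h2 : W.mordellWeilRank = 2) (hS : WeierstrassCurve.SchneiderConjecture D) :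
    ∃ P Q : W.toAffine.Point, D.pairing P P ≠ 0 ∧ D.pairing Q Q ≠ 0 ∧
      ¬ IsSquare (D.pairing P P / D.pairing Q Q) := by
  classical
  obtain ⟨B₀, hB₀⟩ := WeierstrassCurve.exists_isMordellWeilBasis_holds W
  set B : Fin 2 → W.toAffine.Point := B₀ ∘ (finCongr h2).symm with hB
  have hBb : WeierstrassCurve.IsMordellWeilBasis B := hB₀.reindex (finCongr h2)
  have hreg : WeierstrassCurve.padicRegulatorOf D B = WeierstrassCurve.padicRegulator D :=
    hBb.padicRegulatorOf_eq_padicRegulator D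
  have hdet : D.pairing (B 0) (B 0) * D.pairing (B 1) (B 1) -
      D.pairing (B 0) (B 1) * D.pairing (B 0) (B 1) ≠ 0 := by
    have h : WeierstrassCurve.padicRegulatorOf D B ≠ 0 := by
      rw [hreg]; exact hS
    have h' : (D.pairingMatrix B).det ≠ 0 := by
      unfold WeierstrassCurve.padicRegulatorOf at h
      -- (`convert`: the `DecidableEq (Fin 2)` instance inside `padicRegulatorOf` is the classical one)
      convert h using 2
    rw [Matrix.det_fin_two] at h'
    simpa only [WeierstrassCurve.PAdicHeightData.pairingMatrix, Matrix.of_apply,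
      D.symm (B 1) (B 0)] using h'
  obtain ⟨m, n, m', n', h0, h0', hns⟩ :=
    exists_int_ratio_not_isSquare_of_det_ne_zero hp2 hdet
  refine ⟨∑ i, ![m, n] i • B i, ∑ i, ![m', n'] i • B i, ?_, ?_, ?_⟩
  · rw [pairing_comb_self]; exact h0
  · rw [pairing_comb_self]; exact h0'
  · rw [pairing_comb_self, pairing_comb_self]; exact hns

/-- **In rank two, "non-square pair" ⟺ Schneider** for every height datum `D` and `p ≠ 2`
(forward: the landed glue `stub_rank_regulator_of_nonSquarePair`; backward:
`exists_nonSquarePair_of_rank_two`). [cite: MazurSteinTate2006, §1] -/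
theorem exists_nonSquarePair_iff_schneider (hp2 : p ≠ 2) (D : WeierstrassCurve.PAdicHeightData W p)
    (h2 : W.mordellWeilRank = 2) :
    (∃ P Q : W.toAffine.Point, D.pairing P P ≠ 0 ∧ D.pairing Q Q ≠ 0 ∧
      ¬ IsSquare (D.pairing P P / D.pairing Q Q)) ↔ WeierstrassCurve.SchneiderConjecture D :=
  ⟨fun h => (stub_rank_regulator_of_nonSquarePair W p D h).2 h2,
    exists_nonSquarePair_of_rank_two hp2 D h2⟩

/-- `rank_ℤ E(ℚ) = 2` and `Ш(E/ℚ)[p^∞]` finite give `corank_{ℤ_p} Sel_{p^∞}(E/ℚ) ≤ 2` (the Kummer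
corank identity `corank Sel = rank + corank Ш`, tree theorem
`selmerCorank_eq_mordellWeilRank_add_holds`, and `Ш[p^∞]` finite `↔ corank Ш = 0`).
[cite: GreenbergLNM1716, §1] -/
theorem selmerCorank_le_two_of_rank_two (h2 : W.mordellWeilRank = 2)
    (hsha : Finite (AddCommGroup.primaryComponent W.sha p)) : W.selmerCorank p ≤ 2 := by
  have h := W.selmerCorank_eq_mordellWeilRank_add_holds p
  rw [(finite_primaryComponent_sha_iff_shaCorank_eq_zero W p).mp hsha, h2] at h
  omega

/-- **The sector target at `p` implies K at `p`.** For `E/ℚ` (globally minimal `W`) of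
Mordell–Weil rank `2` and a good ordinary prime `p ≥ 5` with `E[p]` irreducible at which
`Ш(E/ℚ)[p^∞]` is finite and every canonical height datum is non-degenerate, the conclusion of the
idea-stub `stub_shadowPrime_rankTwo` holds AT THAT PRIME: `corank Sel_{p^∞} ≤ 2` and every
canonical datum has a non-square pair. [cite: MazurSteinTate2006, §1] -/
theorem shadowPrime_at_of_sector (W : WeierstrassCurve ℚ) [W.IsElliptic] [W.IsGloballyMinimal]
    (p : ℕ) [Fact p.Prime] (h5 : 5 ≤ p) (hord : IsOrdinaryAt W p)
    (hirr : W.HasIrreducibleModPGaloisRep p) (h2 : W.mordellWeilRank = 2)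
    (hsha : Finite (AddCommGroup.primaryComponent W.sha p))
    (hSch : ∀ Dh : WeierstrassCurve.PAdicHeightData W p, Dh.IsCanonical →
      WeierstrassCurve.SchneiderConjecture Dh) :
    ∃ (p : ℕ) (_ : Fact p.Prime), 5 ≤ p ∧ IsOrdinaryAt W p ∧ W.HasIrreducibleModPGaloisRep p ∧
      W.selmerCorank p ≤ 2 ∧
      ∀ Dh : WeierstrassCurve.PAdicHeightData W p, Dh.IsCanonical →
        ∃ P Q : W.toAffine.Point, Dh.pairing P P ≠ 0 ∧ Dh.pairing Q Q ≠ 0 ∧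
          ¬ IsSquare (Dh.pairing P P / Dh.pairing Q Q) := by
  have hp2 : p ≠ 2 := by omega
  exact ⟨p, ‹_›, h5, hord, hirr, selmerCorank_le_two_of_rank_two h2 hsha,
    fun Dh hDh => exists_nonSquarePair_of_rank_two hp2 Dh h2 (hSch Dh hDh)⟩

/-- **Tightness of stub K, direction "sector ⟹ K"**: BSD-rank on the sector {non-CM, `r_an = 2`}
together with the same-prime residual (J) on that sector (one good ordinary irreducible `p ≥ 5`
with `Ш[p^∞]` finite and Schneider for every canonical datum) implies `stub_shadowPrime_rankTwo`
VERBATIM. Combined with the skeleton's `shadowSector_of_stubs` (K + glue G ⟹ the sector target),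
typed K is EQUIVALENT to "BSD-rank ∧ (J)" on its sector: it is that target in the currency of
square classes, neither stronger nor weaker. [cite: MazurSteinTate2006, Conj. 1.1] -/
theorem stub_shadowPrime_rankTwo_of_sector :
    (∀ (W : WeierstrassCurve ℚ) [W.IsElliptic] [W.IsGloballyMinimal], ¬ W.HasCM →
      W.analyticRank = 2 → W.mordellWeilRank = 2) →
    (∀ (W : WeierstrassCurve ℚ) [W.IsElliptic] [W.IsGloballyMinimal], ¬ W.HasCM →
      W.analyticRank = 2 →
      ∃ (p : ℕ) (_ : Fact p.Prime), 5 ≤ p ∧ Literature.NumberTheory.EllipticCurves.IsOrdinaryAt W p ∧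
        W.HasIrreducibleModPGaloisRep p ∧ Finite (AddCommGroup.primaryComponent W.sha p) ∧
        ∀ Dh : WeierstrassCurve.PAdicHeightData W p, Dh.IsCanonical →
          WeierstrassCurve.SchneiderConjecture Dh) →
    ∀ (W : WeierstrassCurve ℚ) [W.IsElliptic] [W.IsGloballyMinimal], ¬ W.HasCM →
      W.analyticRank = 2 →
      ∃ (p : ℕ) (_ : Fact p.Prime), 5 ≤ p ∧ Literature.NumberTheory.EllipticCurves.IsOrdinaryAt W p ∧
        W.HasIrreducibleModPGaloisRep p ∧ W.selmerCorank p ≤ 2 ∧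
        ∀ Dh : WeierstrassCurve.PAdicHeightData W p, Dh.IsCanonical →
          ∃ P Q : W.toAffine.Point, Dh.pairing P P ≠ 0 ∧ Dh.pairing Q Q ≠ 0 ∧
            ¬ IsSquare (Dh.pairing P P / Dh.pairing Q Q) := by
  intro hBSD hJ W _ _ hCM h2an
  obtain ⟨p, hp, h5, hord, hirr, hsha, hSch⟩ := hJ W hCM h2an
  exact shadowPrime_at_of_sector W p h5 hord hirr (hBSD W hCM h2an) hsha hSch

/-- **Tightness of stub K, both directions, as one equivalence.** On the sector
{non-CM, `r_an = 2`}: K (∃ good ordinary irreducible `p ≥ 5` with `corank Sel_{p^∞} ≤ 2` and a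
non-square pair for every canonical datum) holds for every curve of the sector IFF every curve of
the sector has `rank_ℤ E(ℚ) = 2` and satisfies (J) at some good ordinary irreducible `p ≥ 5`.
Forward: glue G (`stub_rank_regulator_of_nonSquarePair`) at a canonical datum
(`exists_isCanonical_holds`) gives `2 ≤ rank`, the squeeze
`mordellWeilRank_eq_of_le_of_selmerCorank_le_holds` gives `rank = 2 = corank Sel`, `corank Ш = 0`,
and G again gives Schneider; backward: `stub_shadowPrime_rankTwo_of_sector`.
[cite: GrossLMS1991, Thm. 1.3] -/
theorem shadowPrime_iff_sector :
    (∀ (W : WeierstrassCurve ℚ) [W.IsElliptic] [W.IsGloballyMinimal], ¬ W.HasCM →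
      W.analyticRank = 2 →
      ∃ (p : ℕ) (_ : Fact p.Prime), 5 ≤ p ∧ Literature.NumberTheory.EllipticCurves.IsOrdinaryAt W p ∧
        W.HasIrreducibleModPGaloisRep p ∧ W.selmerCorank p ≤ 2 ∧
        ∀ Dh : WeierstrassCurve.PAdicHeightData W p, Dh.IsCanonical →
          ∃ P Q : W.toAffine.Point, Dh.pairing P P ≠ 0 ∧ Dh.pairing Q Q ≠ 0 ∧
            ¬ IsSquare (Dh.pairing P P / Dh.pairing Q Q)) ↔
    (∀ (W : WeierstrassCurve ℚ) [W.IsElliptic] [W.IsGloballyMinimal], ¬ W.HasCM →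
      W.analyticRank = 2 →
      W.mordellWeilRank = 2 ∧
        ∃ (p : ℕ) (_ : Fact p.Prime), 5 ≤ p ∧ Literature.NumberTheory.EllipticCurves.IsOrdinaryAt W p ∧
          W.HasIrreducibleModPGaloisRep p ∧ Finite (AddCommGroup.primaryComponent W.sha p) ∧
          ∀ Dh : WeierstrassCurve.PAdicHeightData W p, Dh.IsCanonical →
            WeierstrassCurve.SchneiderConjecture Dh) := by
  constructor
  · intro hK W _ _ hCM h2an
    obtain ⟨p, hp, h5, hord, hirr, hsel, hpair⟩ := hK W hCM h2an
    obtain ⟨D₀, hD₀⟩ := WeierstrassCurve.exists_isCanonical_holds W p h5 hord.1 hord.2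
    have hG₀ := stub_rank_regulator_of_nonSquarePair W p D₀ (hpair D₀ hD₀)
    have hsq :=
      Literature.Barriers.BirchSwinnertonDyer.mordellWeilRank_eq_of_le_of_selmerCorank_le_holds
        W p hG₀.1 hsel
    refine ⟨hsq.1, p, hp, h5, hord, hirr, ?_, fun Dh hDh => ?_⟩
    · exact (finite_primaryComponent_sha_iff_shaCorank_eq_zero W p).mpr hsq.2.2
    · exact (stub_rank_regulator_of_nonSquarePair W p Dh (hpair Dh hDh)).2 hsq.1
  · intro h
    exact stub_shadowPrime_rankTwo_of_sector (fun W _ _ hCM h2 => (h W hCM h2).1)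
      (fun W _ _ hCM h2 => (h W hCM h2).2)

end Curve

end Summit.BirchSwinnertonDyer.BirchSwinnertonDyer.Cruxes.PAdicOrderThesisR2.LambdaAdicGZ

end
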